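import Literature.Probability.RandomPlanarGeometry.SAWTriangularWords
import HarnessLib

/-!
# Counting six-letter words that survive a pruning automaton (Collatz–Wielandt bound, triangular lattice)

Topic `Literature/Probability/RandomPlanarGeometry` (continues `SAWTriangularWords.lean`). This is the
triangular-lattice twin of `SAWWordAutomata.lean` (four letters, `ℤ²`), with the same statements and proofs
on the six-letter alphabet `TriStep`: a deterministic automaton reads a step word letter by letter, its
state after the word `w` being `run step w : Option State` (`none` = the word was killed). If `R` is a set of
states containing the initial state `[]` and closed under the transitions, and `v : State → ℕ`, `v ≥ 1` on
`R`, satisfies the **sub-invariance** (Collatz–Wielandt) inequality `D · Σ_d v(step a d) ≤ N · v(a)` on `R`,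
then the number of surviving words of length `n` is at most `(N/D)ⁿ v([])`. States are step words
(`List TriStep`): the automata we use remember a suffix of the input (Pönitz–Tittmann 2000; Alm 1993).

## Contents (namespace `Literature.Probability.RandomPlanarGeometry.SAW`)

* `triWords_succ`, `sum_triWords_succ` (`Σ_{|w|=n+1} f w = Σ_{|w|=n} Σ_d f (w ++ [d])`);
* `TriWordAutomaton.run step w`, `run_nil`, `run_append_singleton`, `liveWords step n`, `phi`, `weightSum`;
* `TriWordAutomaton.Certificate step R v N D` and the bound
  `card_liveWords_mul_pow_le : #(liveWords n) · Dⁿ ≤ Nⁿ · v []`;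
* `TriWordAutomaton.triSawCount_mul_pow_le`: if every self-avoiding word survives, `c_n(𝕋) · Dⁿ ≤ Nⁿ · v([])`.

## References

* A. Pönitz, P. Tittmann, *Improved upper bounds for self-avoiding walks in ℤᵈ*, Electron. J.
  Combin. 7 (2000) R21, §3 (power iteration on the automaton = largest eigenvalue) [PonitzTittmann2000].
* S. E. Alm, *Upper bounds for the connective constant of self-avoiding walks*, Combin. Probab.
  Comput. 2 (1993) 115–136 [Alm1993].
* L. Collatz, *Einschließungssatz für die charakteristischen Zahlen von Matrizen*, Math. Z. 48
  (1942) 221–226 (the quotient bound `λ_max ≤ max_i (Av)_i / v_i` for `v > 0`).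
-/

open Finset
open scoped BigOperators

namespace Literature.Probability.RandomPlanarGeometry.SAW

/-! ### Splitting off the last letter of a word -/

/-- `triWords (n+1)` is obtained from `triWords n` by appending one letter. [cite: PonitzTittmann2000, §3] -/
theorem triWords_succ (n : ℕ) :
    triWords (n + 1) = (triWords n).biUnion fun w => (univ : Finset TriStep).image fun d => w ++ [d] := by
  ext w
  simp only [mem_triWords, mem_biUnion, mem_image, mem_univ, true_and]
  constructor
  · intro h
    refine ⟨w.take n, by simp [h], w[n]'(by omega), ?_⟩
    conv_rhs => rw [← List.take_append_drop n w]
    rw [List.drop_eq_getElem_cons (by omega), List.drop_of_length_le (by omega)]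
  · rintro ⟨w', hw', d, rfl⟩
    simp [hw']

/-- **Last-letter decomposition of sums over words**:
`Σ_{|w| = n+1} f(w) = Σ_{|w| = n} Σ_d f(w ++ [d])`. [cite: PonitzTittmann2000, §3] -/
theorem sum_triWords_succ {M : Type*} [AddCommMonoid M] (n : ℕ) (f : List TriStep → M) :
    ∑ w ∈ triWords (n + 1), f w = ∑ w ∈ triWords n, ∑ d : TriStep, f (w ++ [d]) := by
  rw [triWords_succ, sum_biUnion]
  · refine sum_congr rfl fun w _ => ?_
    rw [sum_image]
    intro d _ d' _ h
    simpa using List.append_cancel_left h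
  · intro w _ w' _ hne
    simp only [Function.onFun]
    rw [Finset.disjoint_left]
    intro u hu hu'
    simp only [mem_image, mem_univ, true_and] at hu hu'
    obtain ⟨d, rfl⟩ := hu
    obtain ⟨d', h⟩ := hu'
    have := congrArg List.dropLast h
    simp only [List.dropLast_concat] at this
    exact hne this.symm

namespace TriWordAutomaton

variable (step : List TriStep → TriStep → Option (List TriStep))

/-! ### Runs -/

/-- The state of the automaton `step` after reading `w` from the initial state `[]`
(`none` if the word was killed on the way). [cite: PonitzTittmann2000, §2] -/
def run (w : List TriStep) : Option (List TriStep) :=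
  w.foldl (fun o d => o.bind fun a => step a d) (some [])

/-- The run on the empty word is the initial state. [cite: PonitzTittmann2000, §3] -/
@[simp] theorem run_nil : run step [] = some [] := rfl

/-- Reading one more letter. [cite: PonitzTittmann2000, §3] -/
theorem run_append_singleton (w : List TriStep) (d : TriStep) :
    run step (w ++ [d]) = (run step w).bind fun a => step a d := by
  simp [run, List.foldl_append]

/-- The words of length `n` that survive the automaton. [cite: PonitzTittmann2000, §3] -/
def liveWords (n : ℕ) : Finset (List TriStep) := (triWords n).filter fun w => run step w ≠ none

/-- Membership in `liveWords`. [cite: PonitzTittmann2000, §3] -/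
@[simp] theorem mem_liveWords {n : ℕ} {w : List TriStep} :
    w ∈ liveWords step n ↔ w.length = n ∧ run step w ≠ none := by
  simp [liveWords]

/-! ### Certificates and the weighted count -/

/-- A **Collatz–Wielandt certificate** for the automaton `step` with ratio `N/D`: a set of states
`R ∋ []` closed under the transitions and a weight `v ≥ 1` on `R` with
`D · Σ_d v(step a d) ≤ N · v a` for `a ∈ R`. [cite: PonitzTittmann2000, §3] -/
structure Certificate (R : Set (List TriStep)) (v : List TriStep → ℕ) (N D : ℕ) : Prop where
  /-- the initial state is in `R` -/
  nil_mem : [] ∈ R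
  /-- `R` is closed under the transitions -/
  closed : ∀ a ∈ R, ∀ d b, step a d = some b → b ∈ R
  /-- the weight is positive on `R` -/
  one_le : ∀ a ∈ R, 1 ≤ v a
  /-- sub-invariance of the weight -/
  subinv : ∀ a ∈ R, D * ∑ d : TriStep, ((step a d).map v).getD 0 ≤ N * v a

variable {step}

/-- The weight of an optional state (`0` for a killed run). [cite: PonitzTittmann2000, §3] -/
def phi (v : List TriStep → ℕ) : Option (List TriStep) → ℕ
  | none => 0
  | some a => v a

/-- `phi v (some a) = v a`. [cite: PonitzTittmann2000, §3] -/
@[simp] theorem phi_some (v : List TriStep → ℕ) (a : List TriStep) : phi v (some a) = v a := rfl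

/-- `phi v none = 0`. [cite: PonitzTittmann2000, §3] -/
@[simp] theorem phi_none (v : List TriStep → ℕ) : phi v none = 0 := rfl

/-- `phi` of an `Option.map`-style expression. [cite: PonitzTittmann2000, §3] -/
theorem phi_eq_getD (v : List TriStep → ℕ) (o : Option (List TriStep)) : phi v o = (o.map v).getD 0 := by
  cases o <;> rfl

/-- The total weight `Φₙ = Σ_{|w| = n} v(run w)` of the runs of length `n`. [cite: PonitzTittmann2000, §3] -/
def weightSum (step : List TriStep → TriStep → Option (List TriStep)) (v : List TriStep → ℕ) (n : ℕ) : ℕ :=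
  ∑ w ∈ triWords n, phi v (run step w)

/-- `Φ₀ = v([])`. [cite: PonitzTittmann2000, §3] -/
theorem weightSum_zero (v : List TriStep → ℕ) : weightSum step v 0 = v [] := by
  simp [weightSum, triWords]

/-- Surviving runs stay in the closed set `R`. [cite: PonitzTittmann2000, §3] -/
theorem run_mem {R : Set (List TriStep)} {v : List TriStep → ℕ} {N D : ℕ} (hc : Certificate step R v N D)
    (w : List TriStep) {a : List TriStep} (h : run step w = some a) : a ∈ R := by
  induction w using List.reverseRecOn generalizing a with
  | nil => simp only [run_nil, Option.some.injEq] at h; subst h; exact hc.nil_mem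
  | append_singleton w d ih =>
    rw [run_append_singleton] at h
    cases hw : run step w with
    | none => simp [hw] at h
    | some a' => rw [hw, Option.bind_some] at h; exact hc.closed a' (ih hw) d a h

/-- **One step of the weighted count**: `D · Φₙ₊₁ ≤ N · Φₙ`. [cite: PonitzTittmann2000, §3] -/
theorem mul_weightSum_succ_le {R : Set (List TriStep)} {v : List TriStep → ℕ} {N D : ℕ}
    (hc : Certificate step R v N D) (n : ℕ) :
    D * weightSum step v (n + 1) ≤ N * weightSum step v n := by
  rw [weightSum, weightSum, sum_triWords_succ, mul_sum, mul_sum]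
  refine sum_le_sum fun w _ => ?_
  cases hw : run step w with
  | none => simp [run_append_singleton, hw]
  | some a =>
    have ha : a ∈ R := run_mem hc w hw
    simp only [run_append_singleton, hw, Option.bind_some, phi_eq_getD]
    exact hc.subinv a ha

/-- **`Dⁿ Φₙ ≤ Nⁿ v([])`**. [cite: PonitzTittmann2000, §3] -/
theorem pow_mul_weightSum_le {R : Set (List TriStep)} {v : List TriStep → ℕ} {N D : ℕ}
    (hc : Certificate step R v N D) (n : ℕ) :
    D ^ n * weightSum step v n ≤ N ^ n * v [] := by
  induction n with
  | zero => simp [weightSum_zero]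
  | succ n ih =>
    calc D ^ (n + 1) * weightSum step v (n + 1)
        = D ^ n * (D * weightSum step v (n + 1)) := by ring
      _ ≤ D ^ n * (N * weightSum step v n) := Nat.mul_le_mul_left _ (mul_weightSum_succ_le hc n)
      _ = N * (D ^ n * weightSum step v n) := by ring
      _ ≤ N * (N ^ n * v []) := Nat.mul_le_mul_left _ ih
      _ = N ^ (n + 1) * v [] := by ring

/-- The number of surviving words is at most the weighted count. [cite: PonitzTittmann2000, §3] -/
theorem card_liveWords_le_weightSum {R : Set (List TriStep)} {v : List TriStep → ℕ} {N D : ℕ}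
    (hc : Certificate step R v N D) (n : ℕ) :
    (liveWords step n).card ≤ weightSum step v n := by
  rw [liveWords, card_eq_sum_ones, sum_filter, weightSum]
  refine sum_le_sum fun w _ => ?_
  split_ifs with h
  · cases hw : run step w with
    | none => exact absurd hw h
    | some a => exact hc.one_le a (run_mem hc w hw)
  · exact Nat.zero_le _

/-- **Collatz–Wielandt bound for the surviving words**: `#(liveWords n) · Dⁿ ≤ Nⁿ · v([])`.
[cite: PonitzTittmann2000, §3] -/
theorem card_liveWords_mul_pow_le {R : Set (List TriStep)} {v : List TriStep → ℕ} {N D : ℕ}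
    (hc : Certificate step R v N D) (n : ℕ) :
    (liveWords step n).card * D ^ n ≤ N ^ n * v [] :=
  calc (liveWords step n).card * D ^ n ≤ weightSum step v n * D ^ n :=
        Nat.mul_le_mul_right _ (card_liveWords_le_weightSum hc n)
    _ = D ^ n * weightSum step v n := mul_comm _ _
    _ ≤ N ^ n * v [] := pow_mul_weightSum_le hc n

/-- If every self-avoiding word survives, **`c_n(𝕋) · Dⁿ ≤ Nⁿ · v([])`**. [cite: PonitzTittmann2000, §3] -/
theorem triSawCount_mul_pow_le {R : Set (List TriStep)} {v : List TriStep → ℕ} {N D : ℕ}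
    (hc : Certificate step R v N D) (hsaw : ∀ w, IsTriSAW w → run step w ≠ none) (n : ℕ) :
    triSawCount n * D ^ n ≤ N ^ n * v [] := by
  refine le_trans (Nat.mul_le_mul_right _ ?_) (card_liveWords_mul_pow_le hc n)
  rw [triSawCount_eq_card_triSawWords]
  refine card_le_card fun w hw => ?_
  rw [mem_triSawWords] at hw
  exact (mem_liveWords step).2 ⟨hw.1, hsaw w hw.2⟩

end TriWordAutomaton

end Literature.Probability.RandomPlanarGeometry.SAW
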